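import Literature.NumberTheory.EllipticCurves.NewformSymmSquareJ1728Hecke
import Mathlib.NumberTheory.LegendreSymbol.QuadraticChar.Basic
import HarnessLib

/-!
# The character `χ₋₃` and the finite Euler correction `E(σ) = ∏_{p ∣ 6N} F_p(σ)(1 − χ₋₃(p)p^{−σ})`
# for the `j = 0` family

Helper file for the crux `PeterssonLowerBound` (stmt-ABC-10870), stub `stub_j0`: the `j = 0` twin of
the data `chi4C`, `cmCorrection` of `NewformSymmSquareJ1728Hecke` (there for `j = 1728`, `χ₋₄` and the
modulus `M = 4|a|`); here the quadratic character is `χ₋₃ = (·/3)` and the exceptional set of primes is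
that of `6N`. Everything is proved, mostly verbatim from the `j = 1728` file:

* `exists_chi3` — the character `χ₋₃ = (·/3)` as a `DirichletCharacter ℂ 3` (Mathlib's
  `quadraticChar (ZMod 3)`): `χ ≠ 1`, `χ(p) = 1` (`p ≡ 1 (3)`), `= −1` (`p ≡ 2 (3)`);
* for any `χ` mod `3`, the correction `E(σ) = ∏_{p ∣ 6N} symmSqLocalClosed f σ p · (1 − χ(p) p^{−σ})` is
  continuous at `σ = 1` (`continuousAt_j0Correction_one`) with `∏_{p ∣ 6N} (1 − 1/p)³ ≤ ‖E(1)‖`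
  (`norm_j0Correction_one_ge`, `exists_norm_j0Correction_one_ge`).
(No definitions: the character and the parameter are carried as variables, to be instantiated by
`exists_chi3` in the final assembly.)

[cite: IrelandRosen1990, Ch. 18 §6, Theorem 7]
-/

noncomputable section

set_option linter.dupNamespace false

open scoped Real Topology
open Set Filter Complex CongruenceSubgroup
open Literature.NumberTheory.EllipticCurves.ModularForms Literature.NumberTheory.LFunctions

namespace Summit.ABC.ABC.Theorems.PeterssonJ0

/-! ### The character `χ₋₃ = (·/3)` -/

/-- **The quadratic Dirichlet character mod `3`** with complex values exists with the expected values: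
`χ ≠ 1`, `χ(p) = 1` for `p ≡ 1 (3)`, `χ(p) = −1` for `p ≡ 2 (3)` (Mathlib's `quadraticChar (ZMod 3)`
followed by `ℤ → ℂ`; adapted from the tree's `psiThree`). [folklore] -/
theorem exists_chi3 : ∃ χ : DirichletCharacter ℂ 3, χ ≠ 1 ∧ (∀ p : ℕ, p % 3 = 1 → χ p = 1) ∧
    (∀ p : ℕ, p % 3 = 2 → χ p = -1) := by
  -- Euler's criterion mod `3` (adapted from `quadraticChar_zmod_three`, BCDTQuadraticTwistCharacters)
  have hq2 : quadraticChar (ZMod 3) 2 = -1 := by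
    rw [quadraticChar_eq_pow_of_char_ne_two (by rw [ZMod.ringChar_zmod_n]; decide) (by decide), ZMod.card]
    decide
  refine ⟨(quadraticChar (ZMod 3)).ringHomComp (Int.castRingHom ℂ), ?_, ?_, ?_⟩
  · intro h
    have h2 := congrArg (fun χ : DirichletCharacter ℂ 3 ↦ χ (2 : ZMod 3)) h
    simp only [MulChar.ringHomComp_apply, hq2, MulChar.one_apply (show IsUnit (2 : ZMod 3) by decide)] at h2
    norm_num at h2
  · intro p hp
    have h1 : ((p : ℕ) : ZMod 3) = 1 := by
      rw [← ZMod.natCast_mod, hp]; rfl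
    rw [h1, map_one]
  · intro p hp
    have h2 : ((p : ℕ) : ZMod 3) = 2 := by
      rw [← ZMod.natCast_mod, hp]; rfl
    rw [h2, MulChar.ringHomComp_apply, hq2]
    norm_num

/-- `1 − χ(p) p^{−σ} ≠ 0` for `σ > 0`. [folklore] -/
theorem one_sub_chi_mul_ne_zero (χ : DirichletCharacter ℂ 3) {p : ℕ} (hp : p.Prime) {σ : ℝ} (hσ : 0 < σ) :
    (1 : ℂ) - χ p * (p : ℂ) ^ (-(σ : ℂ)) ≠ 0 := by
  -- adapted from `one_sub_chi4C_mul_ne_zero` (NewformSymmSquareJ1728Hecke)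
  intro h
  have h1 : χ p * (p : ℂ) ^ (-(σ : ℂ)) = 1 := by linear_combination -h
  have hn := congrArg norm h1
  rw [norm_mul, norm_one] at hn
  have hy : ‖(p : ℂ) ^ (-(σ : ℂ))‖ < 1 :=
    Literature.NumberTheory.LFunctions.GaussianPrimaryVM.norm_prime_cpow_neg_lt_one hp (by simpa using hσ)
  have : ‖χ p‖ * ‖(p : ℂ) ^ (-(σ : ℂ))‖ < 1 := by
    calc ‖χ p‖ * ‖(p : ℂ) ^ (-(σ : ℂ))‖ ≤ 1 * ‖(p : ℂ) ^ (-(σ : ℂ))‖ := by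
          gcongr; exact DirichletCharacter.norm_le_one χ _
      _ < 1 := by rw [one_mul]; exact hy
  linarith

/-! ### The finite correction `E(σ)` over the primes of `6N` -/

section Correction

variable {N : ℕ} [NeZero N]

variable {W : WeierstrassCurve ℚ} [W.IsElliptic] {f : CuspForm (Gamma0 N) 2} (χ : DirichletCharacter ℂ 3)

/-- **The finite correction `E(σ) = ∏_{p ∣ 6N} F_p(σ) (1 − χ(p) p^{−σ})` is continuous at `σ = 1`**
(finite product of closed local factors with non-vanishing denominators at `1`). [folklore] -/
theorem continuousAt_j0Correction_one (hf : IsNewformOf W f) :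
    ContinuousAt (fun σ : ℝ ↦ ∏ p ∈ (6 * N).primeFactors,
      symmSqLocalClosed f σ p * (1 - χ p * (p : ℂ) ^ (-(σ : ℂ)))) 1 := by
  -- adapted from `IsNewformOf.continuousAt_cmCorrection_one` (NewformSymmSquareJ1728Hecke)
  refine tendsto_finsetProd _ fun p hp ↦ ?_
  have hpp : p.Prime := Nat.prime_of_mem_primeFactors hp
  have hc1 : Continuous fun σ : ℝ ↦ (p : ℂ) ^ (-((σ : ℂ))) := by
    simpa using continuous_prime_cpow_neg hpp 1
  have hc2 : Continuous fun σ : ℝ ↦ (p : ℂ) ^ (-(2 * (σ : ℂ))) := continuous_prime_cpow_neg hpp 2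
  have hchi : ContinuousAt (fun σ : ℝ ↦ (1 : ℂ) - χ p * (p : ℂ) ^ (-(σ : ℂ))) 1 :=
    (continuous_const.sub (continuous_const.mul hc1)).continuousAt
  refine ContinuousAt.mul ?_ hchi
  obtain ⟨D, hD, hval, -, hbad, hgood⟩ := hf.symmSqLocalClosed_one hpp
  obtain ⟨hyC, hy2C, -, -, -⟩ := prime_cpow_neg_ofReal hpp 1
  by_cases hpN : p ∣ N
  · have hform : (fun σ : ℝ ↦ symmSqLocalClosed f σ p) = fun σ : ℝ ↦ (1 - (p : ℂ) ^ (-(2 * (σ : ℂ))))⁻¹ *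
        (1 - ((‖cuspCoeff f p‖ ^ 2 / p : ℝ) : ℂ) * (p : ℂ) ^ (-(σ : ℂ)))⁻¹ * (1 - (p : ℂ) ^ (-(σ : ℂ))) := by
      funext σ; rw [symmSqLocalClosed, if_pos hpN]
    rw [hform]
    have hp1 : (1 : ℝ) < p := by exact_mod_cast hpp.one_lt
    have hp0 : (0 : ℝ) < p := by linarith
    have hx : (p : ℝ) ^ (-(1 : ℝ)) = 1 / p := by rw [Real.rpow_neg_one]; field_simp
    have hxlt : 1 / (p : ℝ) < 1 := by rw [div_lt_one hp0]; exact hp1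
    have ha : ‖cuspCoeff f p‖ ^ 2 ≤ 1 := by
      rw [hf.1.norm_cuspCoeff_sq_of_dvd hpp hpN]; split_ifs <;> norm_num
    have hne1 : (1 : ℂ) - (p : ℂ) ^ (-(2 * ((1 : ℝ) : ℂ))) ≠ 0 := by
      rw [hy2C, hx]
      have h1p : (0 : ℝ) < 1 / p := by positivity
      have : (0 : ℝ) < 1 - (1 / p) ^ 2 := by nlinarith [hxlt, h1p]
      exact_mod_cast this.ne'
    have hne2 : (1 : ℂ) - ((‖cuspCoeff f p‖ ^ 2 / p : ℝ) : ℂ) * (p : ℂ) ^ (-((1 : ℝ) : ℂ)) ≠ 0 := by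
      rw [hyC, hx]
      have : (0 : ℝ) < 1 - ‖cuspCoeff f p‖ ^ 2 / p * (1 / p) := by
        have h' : ‖cuspCoeff f p‖ ^ 2 / p * (1 / p) ≤ 1 * (1 / p) := by
          gcongr; rw [div_le_one hp0]; linarith
        nlinarith [show (0:ℝ) < 1 / p by positivity]
      exact_mod_cast this.ne'
    exact (((continuous_const.sub hc2).continuousAt.inv₀ hne1).mul
      ((continuous_const.sub (continuous_const.mul hc1)).continuousAt.inv₀ hne2)).mul
      (continuous_const.sub hc1).continuousAt
  · have hform : (fun σ : ℝ ↦ symmSqLocalClosed f σ p) = fun σ : ℝ ↦ ((1 - (p : ℂ) ^ (-(σ : ℂ))) *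
        (1 - ((‖cuspCoeff f p‖ ^ 2 / p - 2 : ℝ) : ℂ) * (p : ℂ) ^ (-(σ : ℂ)) + ((p : ℂ) ^ (-(σ : ℂ))) ^ 2))⁻¹ := by
      funext σ; rw [symmSqLocalClosed, if_neg hpN]
    rw [hform]
    have hD' := hgood hpN
    have hne : (1 - (p : ℂ) ^ (-((1 : ℝ) : ℂ))) *
        (1 - ((‖cuspCoeff f p‖ ^ 2 / p - 2 : ℝ) : ℂ) * (p : ℂ) ^ (-((1 : ℝ) : ℂ)) +
          ((p : ℂ) ^ (-((1 : ℝ) : ℂ))) ^ 2) ≠ 0 := by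
      have hx : (p : ℝ) ^ (-(1 : ℝ)) = 1 / p := by rw [Real.rpow_neg_one]; field_simp
      rw [hyC, hx]
      have : ((1 - (1 / (p : ℝ))) * (1 - (‖cuspCoeff f p‖ ^ 2 / p - 2) * (1 / p) + (1 / p) ^ 2) : ℝ) ≠ 0 := by
        rw [← hD']; exact hD.ne'
      exact_mod_cast this
    exact (((continuous_const.sub hc1).mul ((continuous_const.sub (continuous_const.mul hc1)).add
      (hc1.pow 2))).continuousAt.inv₀ hne)

/-- **`|E(1)| ≥ ∏_{p ∣ 6N} (1 − 1/p)³`** (each factor: `|F_p(1)| ≥ (1 − 1/p)²` and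
`|1 − χ(p)/p| ≥ 1 − 1/p`). [folklore] -/
theorem norm_j0Correction_one_ge (hf : IsNewformOf W f) :
    ∏ p ∈ (6 * N).primeFactors, (1 - 1 / (p : ℝ)) ^ 3 ≤
      ‖∏ p ∈ (6 * N).primeFactors, symmSqLocalClosed f 1 p * (1 - χ p * (p : ℂ) ^ (-((1 : ℝ) : ℂ)))‖ := by
  -- adapted from `IsNewformOf.norm_cmCorrection_one_ge` (NewformSymmSquareJ1728Hecke)
  rw [norm_prod]
  refine Finset.prod_le_prod (fun p hp ↦ ?_) (fun p hp ↦ ?_)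
  · have hp2 : (2 : ℝ) ≤ p := by exact_mod_cast (Nat.prime_of_mem_primeFactors hp).two_le
    have : 1 / (p : ℝ) ≤ 1 := by rw [div_le_one (by linarith)]; linarith
    exact pow_nonneg (by linarith) 3
  · have hpp : p.Prime := Nat.prime_of_mem_primeFactors hp
    have hp2 : (2 : ℝ) ≤ p := by exact_mod_cast hpp.two_le
    have hp0 : (0 : ℝ) < p := by linarith
    have hx1 : 1 / (p : ℝ) ≤ 1 := by rw [div_le_one hp0]; linarith
    obtain ⟨D, hD, hval, hge, -, -⟩ := hf.symmSqLocalClosed_one hpp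
    obtain ⟨hyC, -, -, -, -⟩ := prime_cpow_neg_ofReal hpp 1
    have hx : (p : ℝ) ^ (-(1 : ℝ)) = 1 / p := by rw [Real.rpow_neg_one]; field_simp
    rw [norm_mul, hval, Complex.norm_real, Real.norm_of_nonneg (inv_nonneg.mpr hD.le),
      show (1 - 1 / (p : ℝ)) ^ 3 = (1 - 1 / p) ^ 2 * (1 - 1 / p) by ring]
    refine mul_le_mul hge ?_ (by linarith) (inv_nonneg.mpr hD.le)
    have hn : ‖χ p * (p : ℂ) ^ (-((1 : ℝ) : ℂ))‖ ≤ 1 / p := by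
      rw [norm_mul, hyC, hx, Complex.norm_real, Real.norm_of_nonneg (by positivity)]
      calc ‖χ p‖ * (1 / (p : ℝ)) ≤ 1 * (1 / p) := by gcongr; exact DirichletCharacter.norm_le_one χ _
        _ = 1 / p := one_mul _
    have := norm_sub_norm_le (1 : ℂ) (χ p * (p : ℂ) ^ (-((1 : ℝ) : ℂ)))
    rw [norm_one] at this
    linarith

omit χ in
/-- **`‖E(1)‖ ≥ (K (6N)^δ)⁻³`** in the form used downstream: for `δ > 0` there is `K > 0` (independent of
`N`, `W`, `f`, `χ`) with `(K · (6N)^δ)⁻¹ ^ 3 ≤ ‖E(1)‖`. [folklore] -/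
theorem exists_norm_j0Correction_one_ge {δ : ℝ} (hδ : 0 < δ) :
    ∃ K : ℝ, 0 < K ∧ ∀ (N : ℕ) [NeZero N] (W : WeierstrassCurve ℚ) [W.IsElliptic] (f : CuspForm (Gamma0 N) 2)
      (χ : DirichletCharacter ℂ 3), IsNewformOf W f → ((K * ((6 * N : ℕ) : ℝ) ^ δ)⁻¹) ^ 3 ≤
        ‖∏ p ∈ (6 * N).primeFactors, symmSqLocalClosed f 1 p * (1 - χ p * (p : ℂ) ^ (-((1 : ℝ) : ℂ)))‖ := by
  obtain ⟨K, hK, hKp⟩ := exists_prod_primeFactors_one_add_div_le (C := 2) (by norm_num) hδ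
  refine ⟨K, hK, fun N _ W _ f χ hf ↦ ?_⟩
  set M : ℕ := 6 * N with hM
  have hM0 : M ≠ 0 := Nat.mul_ne_zero (by norm_num) (NeZero.ne N)
  have hP := prod_one_sub_pos M
  have h2 : (K * (M : ℝ) ^ δ)⁻¹ ≤ ∏ p ∈ M.primeFactors, (1 - 1 / (p : ℝ)) := by
    refine inv_le_of_inv_le₀ hP ?_
    exact (prod_one_sub_inv_le_prod M).trans (hKp M hM0)
  calc ((K * (M : ℝ) ^ δ)⁻¹) ^ 3 ≤ (∏ p ∈ M.primeFactors, (1 - 1 / (p : ℝ))) ^ 3 :=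
        pow_le_pow_left₀ (by positivity) h2 3
    _ = ∏ p ∈ M.primeFactors, (1 - 1 / (p : ℝ)) ^ 3 := (Finset.prod_pow _ 3 _).symm
    _ ≤ _ := norm_j0Correction_one_ge χ hf

end Correction

end Summit.ABC.ABC.Theorems.PeterssonJ0

namespace Summit.ABC.ABC.Theorems

/-- **Registered sub-goal `stub_j0_correction` of stub `stub_j0`** (crux stmt-ABC-10870): the quadratic
character mod `3` with its values at the primes. [folklore] -/
theorem stub_j0_correction : ∃ χ : DirichletCharacter ℂ 3, χ ≠ 1 ∧ (∀ p : ℕ, p % 3 = 1 → χ p = 1) ∧ (∀ p : ℕ, p % 3 = 2 → χ p = -1) :=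
  PeterssonJ0.exists_chi3

end Summit.ABC.ABC.Theorems

end
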